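import Summits.Ventures.QEC.Thresholds.ToricCodePhenomenologicalAnisotropicThresholds
import Summits.Ventures.QEC.Thresholds.CSSFamilyAnisotropicThresholds
import Literature.InformationTheory.QuantumCodes.TwoRateThreshold
import HarnessLib

/-!
# Two-rate threshold BOXES in the typed vocabulary: `IsThresholdBoxLowerBound` for the toric code (`p₀(4.7599)`,
# decimal `.0111`) and for every census CSS family (`p₀(w+1)`) — UNCONDITIONAL

Venture QEC, `Summits/Ventures/QEC/Thresholds/` (LADDER-QEC rung Q5, PARTITION row 09 "the THRESHOLD definition for (family,
decoder, noise)"; qec-type-09 gen 4, item 09.ANISO). The two-rate theorems (`ToricCodePhenomenologicalAnisotropicThresholds`,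
`CSSFamilyAnisotropicThresholds`) are restated in the vocabulary of `TwoRateThreshold.lean`: the family
`phenomFailureFamily₂ T D : ℕ → ℝ → ℝ → ℝ`, `(L, p, q) ↦ Prob_fail` of the `(L+1) × (L+1)` toric codes monitored for `T L`
rounds with qubit rate `p` and measurement rate `q` (whose diagonal IS `phenomFailureFamily T D`), has
`IsThresholdBoxLowerBound … ρ₀` = "every `0 ≤ p, q < ρ₀` is below threshold" — the certified square inside DKLP's threshold
region. All UNCONDITIONAL, tier CERTIFIED (kernel), axioms standard, 0 facts:

| theorem | statement |
|---|---|
| `phenomFailureFamily₂_diagonal` | `(L, p) ↦ phenomFailureFamily₂ T D L p p` is `phenomFailureFamily T D` |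
| `phenom_isThresholdBoxLowerBound_of_connectiveConstant_le` | `μ(ℤ³) ≤ μ'`, `1 ≤ μ'`, min-weight space-time decoders, poly `T` ⇒ box `p₀(μ')` |
| `phenom_isThresholdBoxLowerBound_kernel`, `phenom_isThresholdBoxLowerBound_0111`, `phenom_mwpm_isThresholdBoxLowerBound_0111` | box `p₀(4.7599)` and the decimal box **`.0111`** (min-weight, resp. every space-time MWPM family) |
| `z_phenom_isThresholdBoxLowerBound_of_rowWeight` / `x_…` | census CSS families (`CSSFamilyThresholds` hypotheses): box `p₀(w+1)` |

## References
* [DennisEtAl2002] E. Dennis, A. Kitaev, A. Landahl, J. Preskill, *Topological quantum memory*, J. Math. Phys. 43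
  (2002) 4452–4505, arXiv:quant-ph/0110143, §4.2, §5.3 eqs. (threshold_iso), (threshold_iso_num).
* [DumerKovalevPryadko2015] I. Dumer, A. A. Kovalev, L. P. Pryadko, PRL 115 (2015) 050502, Thm 3, p. 5.
-/

noncomputable section

namespace Summit.Ventures.QEC.Thresholds

open Filter Topology Finset Matrix
open Literature.InformationTheory.QuantumCodes
open Literature.InformationTheory.QuantumCodes.ToricCode
open Literature.Probability.RandomPlanarGeometry

/-! ### The toric code -/

/-- The **two-rate failure family** of the toric-code memory experiment: `(L, p, q) ↦ Prob_fail` of the `(L+1) × (L+1)`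
code monitored for `T L` rounds by the space-time decoder `D L`, qubit rate `p`, measurement rate `q`.
[cite: DennisEtAl2002, §5.2 (Prob_fail) with §4.2 (rates p, q)] -/
def phenomFailureFamily₂ (T : ℕ → ℕ) (D : (L : ℕ) → STDecoder (L + 1) (T L)) : ℕ → ℝ → ℝ → ℝ :=
  fun L p q => phenomFailureProb (L + 1) (T L) (D L) p q

/-- Its diagonal `q = p` is the tree's one-parameter family `phenomFailureFamily`. [cite: DennisEtAl2002, §5.3 (the case p = q)] -/
theorem phenomFailureFamily₂_diagonal (T : ℕ → ℕ) (D : (L : ℕ) → STDecoder (L + 1) (T L)) :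
    (fun L p => phenomFailureFamily₂ T D L p p) = phenomFailureFamily T D := rfl

/-- **Threshold box `p₀(μ')` from any bound `μ(ℤ³) ≤ μ'`** (`1 ≤ μ'`), every poly-bounded schedule and every
minimum-weight space-time decoder family — UNCONDITIONAL. [cite: DennisEtAl2002, §5.3 eqs. (threshold_iso), (threshold_iso_num)] -/
theorem phenom_isThresholdBoxLowerBound_of_connectiveConstant_le {μ' : ℝ} (hμ'1 : 1 ≤ μ')
    (hμ : SAW.Zd.connectiveConstant 3 ≤ μ') {T : ℕ → ℕ} (hT : IsPolyBounded T)
    {D : (L : ℕ) → STDecoder (L + 1) (T L)}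
    (hD : ∀ L, (D L).IsMinWeight (stSyn (L + 1) (T L)) (stCycles (L + 1) (T L)) hammingNorm) :
    IsThresholdBoxLowerBound (phenomFailureFamily₂ T D) (thresholdValue μ') :=
  fun _ _ hp hq hp' hq' =>
    phenom_aniso_belowThreshold_of_connectiveConstant_le hμ'1 hμ hT hD hp hq (max_lt hp' hq')

/-- **Threshold box `p₀(4.7599)`** (kernel bound `μ(ℤ³) ≤ 4.7599`) — UNCONDITIONAL, kernel.
[cite: DennisEtAl2002, §5.3 eq. (threshold_iso_num)] -/
theorem phenom_isThresholdBoxLowerBound_kernel {T : ℕ → ℕ} (hT : IsPolyBounded T)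
    {D : (L : ℕ) → STDecoder (L + 1) (T L)}
    (hD : ∀ L, (D L).IsMinWeight (stSyn (L + 1) (T L)) (stCycles (L + 1) (T L)) hammingNorm) :
    IsThresholdBoxLowerBound (phenomFailureFamily₂ T D) (thresholdValue 4.7599) :=
  phenom_isThresholdBoxLowerBound_of_connectiveConstant_le (by norm_num)
    SAW.Zd.FiniteMemory3.connectiveConstant_three_le_47599 hT hD

/-- **The decimal box `.0111`**: every `0 ≤ p, q < .0111` is below threshold, for every poly-bounded schedule and every
minimum-weight space-time decoder family — UNCONDITIONAL, kernel (certified LOWER bound on the threshold region).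
[cite: DennisEtAl2002, §5.3 eq. (threshold_iso_num)] -/
theorem phenom_isThresholdBoxLowerBound_0111 {T : ℕ → ℕ} (hT : IsPolyBounded T)
    {D : (L : ℕ) → STDecoder (L + 1) (T L)}
    (hD : ∀ L, (D L).IsMinWeight (stSyn (L + 1) (T L)) (stCycles (L + 1) (T L)) hammingNorm) :
    IsThresholdBoxLowerBound (phenomFailureFamily₂ T D) 0.0111 :=
  (phenom_isThresholdBoxLowerBound_kernel hT hD).mono thresholdValue_47599_bounds.1.le

/-- **The decimal box `.0111` for every space-time MWPM decoder family** — UNCONDITIONAL, kernel.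
[cite: DennisEtAl2002, §5.1 p. 19 and §5.3 eq. (threshold_iso_num)] -/
theorem phenom_mwpm_isThresholdBoxLowerBound_0111 {T : ℕ → ℕ} (hT : IsPolyBounded T)
    (m : (L : ℕ) → EdgeMetric (stLinkEnds (L + 1) (T L))) {D : (L : ℕ) → STDecoder (L + 1) (T L)}
    (hD : ∀ L, IsMatchingDecoder (m L) (D L)) :
    IsThresholdBoxLowerBound (phenomFailureFamily₂ T D) 0.0111 :=
  phenom_isThresholdBoxLowerBound_0111 hT fun L => isMinWeight_of_isMatchingDecoder_st (hD L)

/-! ### Census CSS families -/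

variable {RX RZ Q : ℕ → Type*}

/-- The **two-rate `Z`-sector failure family** of a family of CSS codes monitored for `T i` rounds.
[cite: DumerKovalevPryadko2015, Thm 3 (phenomenological model) with DKLP §4.2 (rates p, q)] -/
def zPhenomFailureFamily₂ [∀ i, Fintype (Q i)] [∀ i, DecidableEq (Q i)] [∀ i, Fintype (RX i)]
    [∀ i, DecidableEq (RX i)] [∀ i, Fintype (RZ i)]
    (C : ∀ i, CSSCode (RX i) (RZ i) (Q i)) (T : ℕ → ℕ)
    (D : ∀ i, CSSPhenom.STDecoder (RX i) (Q i) (T i)) : ℕ → ℝ → ℝ → ℝ :=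
  fun i p q => CSSPhenom.phenomFailureProb (C i).HX (T i) ((C i).rowSpZ : Set (Q i → ZMod 2)) (D i) p q

/-- Its diagonal is `zPhenomFailureFamily`. [cite: DumerKovalevPryadko2015, Thm 3 (q = p)] -/
theorem zPhenomFailureFamily₂_diagonal [∀ i, Fintype (Q i)] [∀ i, DecidableEq (Q i)] [∀ i, Fintype (RX i)]
    [∀ i, DecidableEq (RX i)] [∀ i, Fintype (RZ i)]
    (C : ∀ i, CSSCode (RX i) (RZ i) (Q i)) (T : ℕ → ℕ) (D : ∀ i, CSSPhenom.STDecoder (RX i) (Q i) (T i)) :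
    (fun i p => zPhenomFailureFamily₂ C T D i p p) = zPhenomFailureFamily C T D := rfl

/-- **`Z`-sector threshold box `p₀(w+1)` for census CSS families** (hypotheses of
`z_phenom_isThresholdLowerBound_of_rowWeight`: `X`-checks of weight `≤ w`, `Z`-logicals of weight `≥ d i ≥ 1`,
subexponential space-time size, ANY minimum-weight space-time decoders) — UNCONDITIONAL.
[cite: DumerKovalevPryadko2015, Thm 3 with p. 5 (w → w + 2)] -/
theorem z_phenom_isThresholdBoxLowerBound_of_rowWeight
    [∀ i, Fintype (Q i)] [∀ i, DecidableEq (Q i)] [∀ i, Fintype (RX i)] [∀ i, DecidableEq (RX i)]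
    [∀ i, Fintype (RZ i)]
    (C : ∀ i, CSSCode (RX i) (RZ i) (Q i)) (T : ℕ → ℕ)
    (D : ∀ i, CSSPhenom.STDecoder (RX i) (Q i) (T i))
    (hD : ∀ i, (D i).IsMinWeight (CSSPhenom.stSyn (C i).HX (T i)) (CSSPhenom.stCycles (C i).HX (T i))
      hammingNorm)
    {w : ℕ} (hrow : ∀ i x, (rowSupp (C i).HX x).card ≤ w) (d : ℕ → ℕ) (hd1 : ∀ i, 1 ≤ d i)
    (hd : ∀ i (x : Q i → ZMod 2), (C i).HX *ᵥ x = 0 → x ∉ (C i).rowSpZ → d i ≤ hammingNorm x)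
    (hgrowth : ∀ r : ℝ, 0 < r → r < 1 →
      Tendsto (fun i => (((Fintype.card (Q i) + Fintype.card (RX i)) * T i : ℕ) : ℝ) * r ^ d i)
        atTop (𝓝 0)) :
    IsThresholdBoxLowerBound (zPhenomFailureFamily₂ C T D) (thresholdValue ((w + 1 : ℕ) : ℝ)) :=
  fun _ _ hp hq hp' hq' =>
    z_phenom_aniso_belowThreshold_of_rowWeight C T D hD hrow d hd1 hd hgrowth hp hq (max_lt hp' hq')

/-- The **two-rate `X`-sector failure family**. [cite: DumerKovalevPryadko2015, Thm 3 with DKLP §4.2] -/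
def xPhenomFailureFamily₂ [∀ i, Fintype (Q i)] [∀ i, DecidableEq (Q i)] [∀ i, Fintype (RZ i)]
    [∀ i, DecidableEq (RZ i)] [∀ i, Fintype (RX i)]
    (C : ∀ i, CSSCode (RX i) (RZ i) (Q i)) (T : ℕ → ℕ)
    (D : ∀ i, CSSPhenom.STDecoder (RZ i) (Q i) (T i)) : ℕ → ℝ → ℝ → ℝ :=
  fun i p q => CSSPhenom.phenomFailureProb (C i).HZ (T i) ((C i).rowSpX : Set (Q i → ZMod 2)) (D i) p q

/-- **`X`-sector threshold box `p₀(w+1)` for census CSS families** — UNCONDITIONAL.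
[cite: DumerKovalevPryadko2015, Thm 3 with p. 5 (w → w + 2)] -/
theorem x_phenom_isThresholdBoxLowerBound_of_rowWeight
    [∀ i, Fintype (Q i)] [∀ i, DecidableEq (Q i)] [∀ i, Fintype (RZ i)] [∀ i, DecidableEq (RZ i)]
    [∀ i, Fintype (RX i)]
    (C : ∀ i, CSSCode (RX i) (RZ i) (Q i)) (T : ℕ → ℕ)
    (D : ∀ i, CSSPhenom.STDecoder (RZ i) (Q i) (T i))
    (hD : ∀ i, (D i).IsMinWeight (CSSPhenom.stSyn (C i).HZ (T i)) (CSSPhenom.stCycles (C i).HZ (T i))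
      hammingNorm)
    {w : ℕ} (hrow : ∀ i x, (rowSupp (C i).HZ x).card ≤ w) (d : ℕ → ℕ) (hd1 : ∀ i, 1 ≤ d i)
    (hd : ∀ i (x : Q i → ZMod 2), (C i).HZ *ᵥ x = 0 → x ∉ (C i).rowSpX → d i ≤ hammingNorm x)
    (hgrowth : ∀ r : ℝ, 0 < r → r < 1 →
      Tendsto (fun i => (((Fintype.card (Q i) + Fintype.card (RZ i)) * T i : ℕ) : ℝ) * r ^ d i)
        atTop (𝓝 0)) :
    IsThresholdBoxLowerBound (xPhenomFailureFamily₂ C T D) (thresholdValue ((w + 1 : ℕ) : ℝ)) :=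
  fun _ _ hp hq hp' hq' =>
    x_phenom_aniso_belowThreshold_of_rowWeight C T D hD hrow d hd1 hd hgrowth hp hq (max_lt hp' hq')

end Summit.Ventures.QEC.Thresholds

end
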